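import Summits.QuantumFields.BalabanUV.T4Continuum.Support.MinimalActionRegime
import Summits.QuantumFields.BalabanUV.T4Continuum.Support.ApproxRefineAssembly
import Summits.QuantumFields.BalabanUV.T4Continuum.Support.MinimalActionRateExists
import Summits.QuantumFields.BalabanUV.T4Continuum.Support.MinimalActionExistenceCapstone
import HarnessLib

/-!
# T⁴ programme, node NE3 (η-rate of the minimisers) — THE ACTION SANDWICH, final assembly, part 2:
# ROUTE (A)'s ACTION HALF FROM (H∃) AND THE TWO FILLING BOUNDS OF LEAF R1, UNDER ONE EXPLICIT REGIME

NE3 prover lineage P1, gen 18 (cell `pub-balaban`, unit `b2b-balaban-t4-ne3-p1`, `HOME/BINDER-OWNERS.md` row NE3 OWNER;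
skeleton `t4/b2b-balaban-t4-ne3-p1/SKELETON-NE3-P1.md` v1.4; g17 HANDOFF «NEXT GEN (1): file the FINAL corollary … with
the crew's explicit constants»).

COMPOSITION (every input imported BY NAME; no new mathematics):
* `MinimalActionRateExists.actionRate_sfClass_of_exists_approxRefine` (owner, p212324): (H∃) + `ApproxRefine … m` + six
  numeric side conditions ⇒ `ActionRate (minActReadings d (sfClass d L N ε) L N dom loc) (…) (L⁻²)`;
* `ApproxRefineAssembly.approxRefine_of_fillBounds` (crew leaf-09, p212443): the two regularity bounds of the filled
  pre-compensated configuration `W = fullFill L (precomp L U) (rootH L (precomp L U))` of every class-`j` regular datum —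
  (hfillS) plaquettes `≤ b₁(L^{j+1})^{−2}`, (hfillG) covariant flux gradients `≤ c₁(L^{j+1})^{−3}` — + four side conditions
  ⇒ `ApproxRefine d (sfClass …) L N b c b₁ c₁ m⋆`, `m⋆ = 3(1280·d(d+1)²(d+4)²L²b₁² + d(d+1)c₁ + (d−1)²(c + (37(d−1)+4)b²))`;
* part 1 `MinimalActionRegime`: the regime (Rb) `2¹⁵(d+1)²(d+4)²L²b ≤ 1`, (Rr) `2¹⁰(d+1)(d+4)L²(b₁ + 8mL³/g) ≤ g`,
  (Rε) `2·max b (b₁ + 8mL³/g) ≤ ε` (`g = gap d L = L^{1−d}`, any `m ≥ m⋆`) discharges all ten side conditions.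
ENDs: **`actionRate_sfClass_of_exists_fillBounds`** ((H∃) + hfillS + hfillG + regime ⇒ `T4EtaRateMin.ActionRate … (L⁻²)`
LITERALLY), its limit form **`exists_tendsto_minAct_of_exists_fillBounds`** (`A_k(V) → A(V)` with the geometric tail, via
`ActionRate.exists_limit`), the (H1)∕(H0)-free twin on B11's data class (7) **`actionHalf_of_fillBounds_sfClass₀`**
(leaf-05's `actionHalf_of_approxRefine_sfClass₀` p212452 BY NAME: (H3ˢᵘᵖ) for the `sfClass`-minimisers instead of (H∃)),
and the ONE-THRESHOLD form **`actionRate_sfClass_of_exists_fillBounds_small`**: all radii `≤ t`,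
`2¹⁷(d+1)³(d+4)²L^{2d+3}·t ≤ 1`, `ε ≥ 146(d+1)²L^{d+2}·t` (d = 4, L = 2: `t ≤ 4.6·10⁻¹³`).
WHAT REMAINS OF ROUTE (A): (H∃) [B11 Thm 1 TYPE — crew S3 dictionary `Thm1At ⇒ (H∃)`] and hfillS∕hfillG [crew: F3d
`SkeletonFillFullSmall.smallField_fullFill` ✓ + the root-data translation; F4 = the flux gradient of the filling]; when these
land, a part 3 instantiates `b₁, c₁` as polynomials in `(d, L, b, c)` and route (A) rests on B11 Thm 1 TYPE alone.

HONEST FRAMING.  **NE3 is NOT proved**: (H∃)∕(H3ˢᵘᵖ) and hfillS∕hfillG are hypotheses asserted for nothing; the LOCAL half of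
`T4EtaRateMin.NE3Shape` (readings (D)∕(F); walls δ∕(W2)) is untouched; spine PROVED count 0∕9 unchanged.  No conditional
of the cell (`BetaPertH`, (B), (B^μ), G-an2-4) occurs; nothing printed is a hypothesis of a theorem; every shape imported BY
NAME (`ApproxRefine`, `RegularSup`, `IsMinimiser`, `sfClass`, `minActReadings`, `ActionRate`, `fullFill`, `precomp`,
`rootH`, `SmallField`, `covGrad`, `flux`); no `def`, no `sorry`, axioms ⊆ {propext, Classical.choice, Quot.sound}.  Finite
T⁴ rung (B)+1 = existence and uniqueness of the ε → 0 limit of gauge-invariant observables on a FIXED torus — NOT infinite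
volume, NOT a mass gap, NOT the Clay problem, NOT summit progress.  Context: T. Bałaban, Commun. Math. Phys. **102**
(1985) 277–309 [Balaban1985Variational] (5)–(10) pp. 278–279, Thm 1 p. 279.  PLACEMENT (human rule 2026-08-19):
`Summits/QuantumFields/BalabanUV/`.  HONEST DEPENDENCY (cell page 1): continuum YM on T⁴ ⇐ BetaPertH ∧ nine spine
estimates (0/9 proved); BetaPertH ⇐ (D1) ∧ (D4) ∧ CAP+tail; G-an2-4 gates asym, D1 and NE2/3/4.
-/

set_option autoImplicit false

open scoped BigOperators Matrix Matrix.Norms.L2Operator Topology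
open NormedSpace Filter

namespace Summit.QuantumFields.BalabanUV.T4Continuum.MinimalActionFinal

open Literature.MathematicalPhysics.QuantumFieldTheory.Balaban1983to89
open B7Prop1Explicit B7Prop2Explicit
open T4AveragingDeficitWall hiding Site Plane Plaq Bond
open T4AveragingDeficitNonAbelian (wallConstNA)
open T4EtaRateMin (Readings ActionRate)
open MinimalActionSandwich MinimalActionRate MinimalActionRefine SmoothRefineOfApprox ChainEndFix
open MinimalActionRateExists MinimalActionExistenceCapstone MinimalActionRegime
open SkeletonLattice SkeletonFill SkeletonFillUnitary SkeletonFillFull SkeletonPrecomp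
open ApproxRefineAssembly (approxRefine_of_fillBounds)

noncomputable section

variable {d : ℕ} {n : Type*} [Fintype n] [DecidableEq n] [Nonempty n]

/-! ## §1 Leaf-09's mismatch constant dominates `3(d−1)²c` and is nonnegative -/

/-- For `d ≥ 1` and `b, c, b₁, c₁ ≥ 0`: `3(d−1)²c ≤ m⋆ ≤ m` and `0 ≤ m`, where `m⋆` is leaf-09's closed mismatch constant
(for `d = 0` the constant `37(d−1)+4` is negative and both fail). [folklore] -/
theorem link_of_mstar_le (hd : 1 ≤ d) {b c b₁ c₁ m : ℝ} (L : ℕ) (hc : 0 ≤ c) (hc₁ : 0 ≤ c₁)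
    (hm : 3 * (1280 * d * ((d : ℝ) + 1) ^ 2 * ((d : ℝ) + 4) ^ 2 * (L : ℝ) ^ 2 * b₁ ^ 2 + d * ((d : ℝ) + 1) * c₁
        + ((d : ℝ) - 1) ^ 2 * (c + (37 * ((d : ℝ) - 1) + 4) * b ^ 2)) ≤ m) :
    3 * ((d : ℝ) - 1) ^ 2 * c ≤ m ∧ 0 ≤ m := by
  have hd0 : (0 : ℝ) ≤ d := Nat.cast_nonneg d
  have hd1 : (1 : ℝ) ≤ d := by exact_mod_cast hd
  have hT1 : 0 ≤ 1280 * d * ((d : ℝ) + 1) ^ 2 * ((d : ℝ) + 4) ^ 2 * (L : ℝ) ^ 2 * b₁ ^ 2 := by positivity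
  have hT2 : 0 ≤ (d : ℝ) * ((d : ℝ) + 1) * c₁ := by positivity
  have h37 : 0 ≤ 37 * ((d : ℝ) - 1) + 4 := by linarith
  have hT3 : 0 ≤ ((d : ℝ) - 1) ^ 2 * ((37 * ((d : ℝ) - 1) + 4) * b ^ 2) := by positivity
  have hsq : 0 ≤ ((d : ℝ) - 1) ^ 2 * c := mul_nonneg (sq_nonneg _) hc
  have hsplit : ((d : ℝ) - 1) ^ 2 * (c + (37 * ((d : ℝ) - 1) + 4) * b ^ 2)
      = ((d : ℝ) - 1) ^ 2 * c + ((d : ℝ) - 1) ^ 2 * ((37 * ((d : ℝ) - 1) + 4) * b ^ 2) := by ring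
  rw [hsplit] at hm
  constructor <;> linarith

/-! ## §2 The ENDs of route (A) under the regime -/

/-- **ROUTE (A)'s ACTION HALF FROM (H∃) AND THE TWO FILLING BOUNDS, UNDER THE REGIME.**  For `d ≥ 1`, `L, N ≥ 1`, radii
`b, c, b₁, c₁ ≥ 0`, any `m ≥ m⋆ = 3(1280·d(d+1)²(d+4)²L²b₁² + d(d+1)c₁ + (d−1)²(c + (37(d−1)+4)b²))`, and a class radius `ε`
with (Rb) `2¹⁵(d+1)²(d+4)²L²·b ≤ 1`, (Rr) `2¹⁰(d+1)(d+4)L²·(b₁ + 8mL³/g) ≤ g` (`g = gap d L = L^{1−d}`), (Rε)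
`2·max b (b₁ + 8mL³/g) ≤ ε`: IF (H∃) every datum of `dom` has at every level SOME minimiser over `sfClass d L N ε` with
sup-form regularity `(b, c)` ([Balaban1985Variational] Thm 1 (8)+(9) TYPE — a hypothesis), and IF the filled pre-compensated
configuration of every class-`j` regular datum has plaquettes `≤ b₁(L^{j+1})^{−2}` (hfillS) and covariant flux gradients
`≤ c₁(L^{j+1})^{−3}` (hfillG), THEN `ActionRate (minActReadings d (sfClass d L N ε) L N dom loc)
(wallConstNA(d,L)·(gradConst d (max c (c₁ + 36mL³/g)) + (max b (b₁ + 8mL³/g))³)/L²) (L⁻²)` — `T4EtaRateMin.ActionRate` BY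
NAME, for every supplied local reading `loc`.  NE3 is NOT proved by this. [folklore] -/
theorem actionRate_sfClass_of_exists_fillBounds (hd : 1 ≤ d) {L N : ℕ} (hL : 1 ≤ L) (hN : 1 ≤ N)
    {b c b₁ c₁ m ε : ℝ} (hb : 0 ≤ b) (hc : 0 ≤ c) (hb₁ : 0 ≤ b₁) (hc₁ : 0 ≤ c₁)
    (hm : 3 * (1280 * d * ((d : ℝ) + 1) ^ 2 * ((d : ℝ) + 4) ^ 2 * (L : ℝ) ^ 2 * b₁ ^ 2 + d * ((d : ℝ) + 1) * c₁
        + ((d : ℝ) - 1) ^ 2 * (c + (37 * ((d : ℝ) - 1) + 4) * b ^ 2)) ≤ m)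
    (hRb : 2 ^ 15 * ((d : ℝ) + 1) ^ 2 * ((d : ℝ) + 4) ^ 2 * (L : ℝ) ^ 2 * b ≤ 1)
    (hRr : 2 ^ 10 * ((d : ℝ) + 1) * ((d : ℝ) + 4) * (L : ℝ) ^ 2 * (b₁ + 8 * m * (L : ℝ) ^ 3 / gap d L) ≤ gap d L)
    (hRε : 2 * max b (b₁ + 8 * m * (L : ℝ) ^ 3 / gap d L) ≤ ε)
    {dom : Set (Site d → Fin d → (Matrix n n ℂ)ˣ)}
    (hmin : ∀ V ∈ dom, ∀ k : ℕ, ∃ U, IsMinimiser d (sfClass d L N ε) L N k V U ∧ RegularSup d L N b c k U)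
    (hfillS : ∀ (j : ℕ) (U : Site d → Fin d → (Matrix n n ℂ)ˣ), U ∈ sfClass (d := d) L N ε j →
      RegularSup d L N b c j U →
      SmallField (fullFill L (precomp L U) (rootH L (precomp L U))) (b₁ / ((L : ℝ) ^ (j + 1)) ^ 2))
    (hfillG : ∀ (j : ℕ) (U : Site d → Fin d → (Matrix n n ℂ)ˣ), U ∈ sfClass (d := d) L N ε j →
      RegularSup d L N b c j U → ∀ (x : Site d) (κ : Fin d) (π : T4AveragingDeficitWall.Plane d),
      ‖covGrad (fullFill L (precomp L U) (rootH L (precomp L U)))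
          (flux (fullFill L (precomp L U) (rootH L (precomp L U)))) x κ π‖ ≤ c₁ / ((L : ℝ) ^ (j + 1)) ^ 3)
    {X : Type*} (loc : ℕ → (Site d → Fin d → (Matrix n n ℂ)ˣ) → X → ℝ) :
    ActionRate (minActReadings d (sfClass d L N ε) L N dom loc)
      (wallConstNA d L * (gradConst d (max c (c₁ + 36 * m * (L : ℝ) ^ 3 / gap d L))
        + (max b (b₁ + 8 * m * (L : ℝ) ^ 3 / gap d L)) ^ 3) / (L : ℝ) ^ 2) (((L : ℝ) ^ 2)⁻¹) := by
  obtain ⟨hcm, hm0⟩ := link_of_mstar_le hd L hc hc₁ hm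
  obtain ⟨h16, hhalf', hquarter, h512⟩ := fillConds_of_regime hL hb hc hb₁ hm0 hcm hRb hRr
  obtain ⟨hBs, hbε, hbs₁, hgap, hhalf, hε⟩ := sideConds_of_regime hL hb hb₁ hm0 hRb hRr hRε
  have hA : ApproxRefine d (sfClass (d := d) (n := n) L N ε) L N b c b₁ c₁ m :=
    approxRefine_mono (approxRefine_of_fillBounds hd L N hL hb hc hb₁ hc₁ h16 hhalf' hquarter h512 hfillS hfillG) hm
  exact actionRate_sfClass_of_exists_approxRefine hL hN hb hb₁ hm0 hBs hbε hbs₁ hgap hhalf hε hmin hA loc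

/-- The LIMIT form: under the same hypotheses and `L ≥ 2` (so that the rate `L⁻²` is `< 1`), for every datum `V ∈ dom` the
minimal actions `A_k(V) = minAct d (sfClass d L N ε) L N k V` converge, with the geometric tail
`|A_k(V) − A(V)| ≤ C·N^d·(L⁻²)^k/(1 − L⁻²)` (`T4EtaRateMin.ActionRate.exists_limit` BY NAME). [folklore] -/
theorem exists_tendsto_minAct_of_exists_fillBounds (hd : 1 ≤ d) {L N : ℕ} (hL : 2 ≤ L) (hN : 1 ≤ N)
    {b c b₁ c₁ m ε : ℝ} (hb : 0 ≤ b) (hc : 0 ≤ c) (hb₁ : 0 ≤ b₁) (hc₁ : 0 ≤ c₁)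
    (hm : 3 * (1280 * d * ((d : ℝ) + 1) ^ 2 * ((d : ℝ) + 4) ^ 2 * (L : ℝ) ^ 2 * b₁ ^ 2 + d * ((d : ℝ) + 1) * c₁
        + ((d : ℝ) - 1) ^ 2 * (c + (37 * ((d : ℝ) - 1) + 4) * b ^ 2)) ≤ m)
    (hRb : 2 ^ 15 * ((d : ℝ) + 1) ^ 2 * ((d : ℝ) + 4) ^ 2 * (L : ℝ) ^ 2 * b ≤ 1)
    (hRr : 2 ^ 10 * ((d : ℝ) + 1) * ((d : ℝ) + 4) * (L : ℝ) ^ 2 * (b₁ + 8 * m * (L : ℝ) ^ 3 / gap d L) ≤ gap d L)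
    (hRε : 2 * max b (b₁ + 8 * m * (L : ℝ) ^ 3 / gap d L) ≤ ε)
    {dom : Set (Site d → Fin d → (Matrix n n ℂ)ˣ)}
    (hmin : ∀ V ∈ dom, ∀ k : ℕ, ∃ U, IsMinimiser d (sfClass d L N ε) L N k V U ∧ RegularSup d L N b c k U)
    (hfillS : ∀ (j : ℕ) (U : Site d → Fin d → (Matrix n n ℂ)ˣ), U ∈ sfClass (d := d) L N ε j →
      RegularSup d L N b c j U →
      SmallField (fullFill L (precomp L U) (rootH L (precomp L U))) (b₁ / ((L : ℝ) ^ (j + 1)) ^ 2))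
    (hfillG : ∀ (j : ℕ) (U : Site d → Fin d → (Matrix n n ℂ)ˣ), U ∈ sfClass (d := d) L N ε j →
      RegularSup d L N b c j U → ∀ (x : Site d) (κ : Fin d) (π : T4AveragingDeficitWall.Plane d),
      ‖covGrad (fullFill L (precomp L U) (rootH L (precomp L U)))
          (flux (fullFill L (precomp L U) (rootH L (precomp L U)))) x κ π‖ ≤ c₁ / ((L : ℝ) ^ (j + 1)) ^ 3)
    {V : Site d → Fin d → (Matrix n n ℂ)ˣ} (hV : V ∈ dom) :
    ∃ A : ℝ, Tendsto (fun k => minAct d (sfClass d L N ε) L N k V) atTop (𝓝 A) ∧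
      ∀ k : ℕ, |minAct d (sfClass d L N ε) L N k V - A|
        ≤ wallConstNA d L * (gradConst d (max c (c₁ + 36 * m * (L : ℝ) ^ 3 / gap d L))
            + (max b (b₁ + 8 * m * (L : ℝ) ^ 3 / gap d L)) ^ 3) / (L : ℝ) ^ 2 * (N : ℝ) ^ d
            * (((L : ℝ) ^ 2)⁻¹) ^ k / (1 - ((L : ℝ) ^ 2)⁻¹) :=
  (actionRate_sfClass_of_exists_fillBounds hd (by omega) hN hb hc hb₁ hc₁ hm hRb hRr hRε hmin hfillS hfillG
    (fun _ _ (_ : Unit) => (0 : ℝ))).exists_limit (rate_lt_one hL).2 hV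

/-- **THE (H1)∕(H0)-FREE TWIN ON B11's DATA CLASS (7)** (leaf-05's `actionHalf_of_approxRefine_sfClass₀` BY NAME, under the
regime): for `L ≥ 2`, data `dom ⊆ sfClass d L N ε₁ 0` with `ε₁ ≤ 1/4`, `ε₁ ≤ b`, `4ε₁ ≤ c`, class radius in the averaging
regime `16·C₀(d)·ε ≤ 3`, `1024(d+1)(d+4)L²ε ≤ 1`: IF (H3ˢᵘᵖ) every minimiser of runs `k+1` over `sfClass d L N ε` is
`RegularSup (b, c)` and IF hfillS∕hfillG, THEN `0 ≤ L⁻² < 1` and the same `ActionRate` (existence of minimisers by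
compactness, level-0 regularity from the data class).  NE3 is NOT proved by this. [folklore] -/
theorem actionHalf_of_fillBounds_sfClass₀ (hd : 1 ≤ d) {L N : ℕ} (hL : 2 ≤ L) (hN : 1 ≤ N)
    {b c b₁ c₁ m ε ε₁ : ℝ} (hb : 0 ≤ b) (hc : 0 ≤ c) (hb₁ : 0 ≤ b₁) (hc₁ : 0 ≤ c₁)
    (hm : 3 * (1280 * d * ((d : ℝ) + 1) ^ 2 * ((d : ℝ) + 4) ^ 2 * (L : ℝ) ^ 2 * b₁ ^ 2 + d * ((d : ℝ) + 1) * c₁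
        + ((d : ℝ) - 1) ^ 2 * (c + (37 * ((d : ℝ) - 1) + 4) * b ^ 2)) ≤ m)
    (hRb : 2 ^ 15 * ((d : ℝ) + 1) ^ 2 * ((d : ℝ) + 4) ^ 2 * (L : ℝ) ^ 2 * b ≤ 1)
    (hRr : 2 ^ 10 * ((d : ℝ) + 1) * ((d : ℝ) + 4) * (L : ℝ) ^ 2 * (b₁ + 8 * m * (L : ℝ) ^ 3 / gap d L) ≤ gap d L)
    (hRε : 2 * max b (b₁ + 8 * m * (L : ℝ) ^ 3 / gap d L) ≤ ε)
    (hε1 : 16 * C0 d * ε ≤ 3) (hε2 : 1024 * (d + 1) * (d + 4) * (L : ℝ) ^ 2 * ε ≤ 1)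
    (hε₁ : ε₁ ≤ 1 / 4) (hε₁b : ε₁ ≤ b) (hε₁c : 4 * ε₁ ≤ c)
    {dom : Set (Site d → Fin d → (Matrix n n ℂ)ˣ)} (hdom : dom ⊆ sfClass d L N ε₁ 0)
    (h3 : ∀ V ∈ dom, ∀ (k : ℕ) (U : Site d → Fin d → (Matrix n n ℂ)ˣ),
      IsMinimiser d (sfClass d L N ε) L N (k + 1) V U → RegularSup d L N b c (k + 1) U)
    (hfillS : ∀ (j : ℕ) (U : Site d → Fin d → (Matrix n n ℂ)ˣ), U ∈ sfClass (d := d) L N ε j →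
      RegularSup d L N b c j U →
      SmallField (fullFill L (precomp L U) (rootH L (precomp L U))) (b₁ / ((L : ℝ) ^ (j + 1)) ^ 2))
    (hfillG : ∀ (j : ℕ) (U : Site d → Fin d → (Matrix n n ℂ)ˣ), U ∈ sfClass (d := d) L N ε j →
      RegularSup d L N b c j U → ∀ (x : Site d) (κ : Fin d) (π : T4AveragingDeficitWall.Plane d),
      ‖covGrad (fullFill L (precomp L U) (rootH L (precomp L U)))
          (flux (fullFill L (precomp L U) (rootH L (precomp L U)))) x κ π‖ ≤ c₁ / ((L : ℝ) ^ (j + 1)) ^ 3)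
    {X : Type*} (loc : ℕ → (Site d → Fin d → (Matrix n n ℂ)ˣ) → X → ℝ) :
    0 ≤ ((L : ℝ) ^ 2)⁻¹ ∧ ((L : ℝ) ^ 2)⁻¹ < 1 ∧
      ActionRate (minActReadings d (sfClass d L N ε) L N dom loc)
        (wallConstNA d L * (gradConst d (max c (c₁ + 36 * m * (L : ℝ) ^ 3 / gap d L))
          + (max b (b₁ + 8 * m * (L : ℝ) ^ 3 / gap d L)) ^ 3) / (L : ℝ) ^ 2) (((L : ℝ) ^ 2)⁻¹) := by
  have hL1 : 1 ≤ L := by omega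
  obtain ⟨hcm, hm0⟩ := link_of_mstar_le hd L hc hc₁ hm
  obtain ⟨h16, hhalf', hquarter, h512⟩ := fillConds_of_regime hL1 hb hc hb₁ hm0 hcm hRb hRr
  obtain ⟨hBs, hbε, hbs₁, hgap, hhalf, hε⟩ := sideConds_of_regime hL1 hb hb₁ hm0 hRb hRr hRε
  have hA : ApproxRefine d (sfClass (d := d) (n := n) L N ε) L N b c b₁ c₁ m :=
    approxRefine_mono (approxRefine_of_fillBounds hd L N hL1 hb hc hb₁ hc₁ h16 hhalf' hquarter h512 hfillS hfillG) hm
  exact actionHalf_of_approxRefine_sfClass₀ hL hN hb hb₁ hm0 hBs hbε hbs₁ hgap hhalf hε hε1 hε2 hε₁ hε₁b hε₁c hdom h3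
    hA loc

/-! ## §3 The one-threshold form -/

/-- **ROUTE (A)'s ACTION HALF BELOW ONE EXPLICIT THRESHOLD**: for `d ≥ 1`, `L, N ≥ 1`, radii `0 ≤ b, b₁, c, c₁ ≤ t` with
`2¹⁷(d+1)³(d+4)²L^{2d+3}·t ≤ 1` and a class radius `ε ≥ 146(d+1)²L^{d+2}·t`, (H∃) + hfillS + hfillG give
`ActionRate (minActReadings d (sfClass d L N ε) L N dom loc) (C) (L⁻²)` with
`C = wallConstNA(d,L)·(gradConst d (max c (c₁ + 324(d+1)²L^{d+2}t)) + (max b (b₁ + 72(d+1)²L^{d+2}t))³)/L²`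
(d = 4, L = 2: `t ≤ 4.6·10⁻¹³`, `ε ≥ 2.4·10⁵·t`).  NE3 is NOT proved by this. [folklore] -/
theorem actionRate_sfClass_of_exists_fillBounds_small (hd : 1 ≤ d) {L N : ℕ} (hL : 1 ≤ L) (hN : 1 ≤ N)
    {t b c b₁ c₁ ε : ℝ} (hb : 0 ≤ b) (hc : 0 ≤ c) (hb₁ : 0 ≤ b₁) (hc₁ : 0 ≤ c₁)
    (hbt : b ≤ t) (hct : c ≤ t) (hb₁t : b₁ ≤ t) (hc₁t : c₁ ≤ t)
    (ht : 2 ^ 17 * ((d : ℝ) + 1) ^ 3 * ((d : ℝ) + 4) ^ 2 * (L : ℝ) ^ (2 * d + 3) * t ≤ 1)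
    (hεt : 146 * ((d : ℝ) + 1) ^ 2 * (L : ℝ) ^ (d + 2) * t ≤ ε)
    {dom : Set (Site d → Fin d → (Matrix n n ℂ)ˣ)}
    (hmin : ∀ V ∈ dom, ∀ k : ℕ, ∃ U, IsMinimiser d (sfClass d L N ε) L N k V U ∧ RegularSup d L N b c k U)
    (hfillS : ∀ (j : ℕ) (U : Site d → Fin d → (Matrix n n ℂ)ˣ), U ∈ sfClass (d := d) L N ε j →
      RegularSup d L N b c j U →
      SmallField (fullFill L (precomp L U) (rootH L (precomp L U))) (b₁ / ((L : ℝ) ^ (j + 1)) ^ 2))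
    (hfillG : ∀ (j : ℕ) (U : Site d → Fin d → (Matrix n n ℂ)ˣ), U ∈ sfClass (d := d) L N ε j →
      RegularSup d L N b c j U → ∀ (x : Site d) (κ : Fin d) (π : T4AveragingDeficitWall.Plane d),
      ‖covGrad (fullFill L (precomp L U) (rootH L (precomp L U)))
          (flux (fullFill L (precomp L U) (rootH L (precomp L U)))) x κ π‖ ≤ c₁ / ((L : ℝ) ^ (j + 1)) ^ 3)
    {X : Type*} (loc : ℕ → (Site d → Fin d → (Matrix n n ℂ)ˣ) → X → ℝ) :
    ActionRate (minActReadings d (sfClass d L N ε) L N dom loc)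
      (wallConstNA d L * (gradConst d (max c (c₁ + 324 * ((d : ℝ) + 1) ^ 2 * (L : ℝ) ^ (d + 2) * t))
        + (max b (b₁ + 72 * ((d : ℝ) + 1) ^ 2 * (L : ℝ) ^ (d + 2) * t)) ^ 3) / (L : ℝ) ^ 2) (((L : ℝ) ^ 2)⁻¹) := by
  obtain ⟨hm, hRb, hRr, hRε⟩ := regime_of_small hd hL hb hb₁ hbt hct hb₁t hc₁t ht
  have hL1 : (1 : ℝ) ≤ L := by exact_mod_cast hL
  have hL0 : (0 : ℝ) < L := by linarith
  have hL3g : (L : ℝ) ^ 3 / gap d L = (L : ℝ) ^ (d + 2) := by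
    rw [gap_eq hL hd, div_div_eq_mul_div, pow_add,
      show (L : ℝ) ^ 3 * (L : ℝ) ^ d = (L : ℝ) ^ d * (L : ℝ) ^ 2 * L by ring, mul_div_cancel_right₀ _ hL0.ne']
  have h := actionRate_sfClass_of_exists_fillBounds hd hL hN hb hc hb₁ hc₁ hm hRb hRr (hRε.trans hεt) hmin hfillS
    hfillG loc
  have e1 : 36 * (9 * ((d : ℝ) + 1) ^ 2 * t) * (L : ℝ) ^ 3 / gap d L = 324 * ((d : ℝ) + 1) ^ 2 * (L : ℝ) ^ (d + 2) * t := by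
    rw [mul_div_assoc, hL3g]; ring
  have e2 : 8 * (9 * ((d : ℝ) + 1) ^ 2 * t) * (L : ℝ) ^ 3 / gap d L = 72 * ((d : ℝ) + 1) ^ 2 * (L : ℝ) ^ (d + 2) * t := by
    rw [mul_div_assoc, hL3g]; ring
  rw [e1, e2] at h
  exact h

end

end Summit.QuantumFields.BalabanUV.T4Continuum.MinimalActionFinal
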